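import Summits.AnomalousDissipation.AnomalousDissipation.Theorems.BaireTransferDenseLoudDesignerForcesErgodicLine
import Literature.Analysis.FluidPDE.TorusLinearisedNSH2Smoothing

/-!
# `V → H²` smoothing of the linearised flow on `T³` (tools stub `stub_linearisedH2SmoothingTools`, block N-C, line
# `ergodic-budget-selection-closing`, crux `BaireTransfer.DenseLoudDesignerForces`, stmt-AnomalousDissipation-1143)

Summit-side specialisation to `T³ = UnitAddTorus (Fin 3)` of the Literature estimate
`Torus.linearisedNS_integral_norm_laplacian_sq_le_mul` (`Literature/Analysis/FluidPDE/TorusLinearisedNSH2Smoothing.lean`,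
over the `H²` balance and flux bound of `Literature/Analysis/FluidPDE/TorusLinearisedNSH2Balance.lean`), read against the
line's predicate `IsLinearizedNSSolutionOn S ν u w q` (file `…ErgodicLine.lean`: `w, q` jointly smooth, `div w(t) = 0`,
`∫ w(t) = 0`, `∂ₜw + (u·∇)w + (w·∇)u = νΔw − ∇q`): along a jointly smooth divergence-free base field `u` on
`[a, a + τ] × T³` with `‖u‖ ≤ M`, `‖∂ᵢu‖ ≤ Λ₁` and `‖Δu(t)‖₂² ≤ Y₁`, every linearised solution satisfies
`‖Δw(a + τ)‖₂² ≤ C(ν, M, Λ₁, Y₁, τ) (‖w(a)‖₂² + ‖∇w(a)‖₂²)` — the solution operator of the first variation equation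
maps `V` boundedly into `D(A)` after any positive time lapse (Constantin–Foias 1988 Ch. 14, one Sobolev level above
"`S'(t, u₀)` maps `H` into `V` boundedly"); with Rellich this is the compactness half of the derivative cocycle on `V`
(block N-C of the smooth-model construction).  The registered tools stub `stub_linearisedH2SmoothingTools` is proved
BY NAME with exactly the registered signature.

References: P. Constantin, C. Foias, *Navier–Stokes Equations* (1988) Ch. 14 (14.2)–(14.4), Prop. 13.2, Thm 10.6;
R. Temam, *Infinite-Dimensional Dynamical Systems in Mechanics and Physics* (1997) Ch. VI §3.1.
-/

-- `Summit.<Summit>.<Problem>` is the tree's mandated summit-side namespace (CONVENTIONS §2); for this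
-- single-conjunct summit the two coincide, so the duplicate is deliberate.
set_option linter.dupNamespace false

noncomputable section

open scoped BigOperators Topology ENNReal InnerProductSpace
open Filter Set Function MeasureTheory

namespace Summit.AnomalousDissipation.AnomalousDissipation.Theorems.DenseLoudDesignerForces.Ergodic

open Literature.Analysis.FunctionSpaces Literature.Analysis.FunctionSpaces.Torus
open Literature.Analysis.FluidPDE Literature.Analysis.FluidPDE.Torus

/-- **Tools stub C1 of block N-C (`stub_linearisedH2SmoothingTools`, crux stmt-AnomalousDissipation-1143, line
`ergodic-budget-selection-closing`) — `V → H²` smoothing of the linearised flow.**  For `ν > 0`, levels `M, Λ₁, Y₁`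
and a time lapse `τ > 0` there is `C` such that: along every jointly smooth divergence-free base field `u` on
`[a, a + τ] × T³` with `‖u‖ ≤ M`, `‖∂ᵢu‖ ≤ Λ₁` and `‖Δu(t)‖₂² ≤ Y₁`, every solution `(w, q)` of the linearised system
(`IsLinearizedNSSolutionOn`: smooth, divergence free, mean zero) satisfies
`∫ ‖Δw(a + τ)‖² ≤ C (∫ ‖w(a)‖² + ‖∇w(a)‖₂²)` — the `H²` balance
`d/dt ½‖Δw‖₂² = −ν‖∇Δw‖₂² − ∫⟪(u·∇)w + (w·∇)u, ΔΔw⟫`, its flux bound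
`≤ K₁(‖∇w‖₂² + ‖Δw‖₂²)` on `T³` (sup-norm embedding of the mean-zero `w`), the `H¹` balance keeping half the
dissipation, the exponential `H¹` bound of the linearised flow and the time weight `(t − a)·½‖Δw‖₂²`
(`Torus.linearisedNS_integral_norm_laplacian_sq_le_mul` at `d = Fin 3`, the conjunction `IsLinearizedNSSolutionOn`
unpacked).  Constantin–Foias 1988 Ch. 14, "`S′(t,u₀) : H → V` bounded", one level up.
[cite: ConstantinFoiasNSE1988, Ch. 14 (text after (14.4)) with Prop. 13.2 and Thm 10.6] -/
theorem stub_linearisedH2SmoothingTools {ν : ℝ} (hν : 0 < ν) (M Λ₁ Y₁ τ : ℝ) (hτ : 0 < τ) :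
    ∃ C : ℝ, ∀ {a : ℝ} {u w : ℝ → (UnitAddTorus (Fin 3)) → (EuclideanSpace ℝ (Fin 3))} {q : ℝ → (UnitAddTorus (Fin 3)) → ℝ},
      IsSmoothSpaceTimeOn (Icc a (a + τ)) u → (∀ t ∈ Icc a (a + τ), IsDivFree (u t)) →
      (∀ t ∈ Icc a (a + τ), ∀ x, ‖u t x‖ ≤ M) → (∀ i, ∀ t ∈ Icc a (a + τ), ∀ x, ‖partialDeriv i (u t) x‖ ≤ Λ₁) →
      (∀ t ∈ Icc a (a + τ), ∫ x, ‖laplacian (u t) x‖ ^ 2 ≤ Y₁) →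
      IsLinearizedNSSolutionOn (Icc a (a + τ)) ν u w q →
      ∫ x, ‖laplacian (w (a + τ)) x‖ ^ 2 ≤ C * ((∫ x, ‖w a x‖ ^ 2) + gradNormSq (w a)) := by
  obtain ⟨C, hC⟩ := linearisedNS_integral_norm_laplacian_sq_le_mul (d := Fin 3) (Fintype.card_fin 3) hν M Λ₁ Y₁ hτ
  exact ⟨C, fun hu hudiv hM hΛ hY h => hC hu hudiv hM hΛ hY h.1 h.2.1 h.2.2.1 h.2.2.2.1 h.2.2.2.2⟩

end Summit.AnomalousDissipation.AnomalousDissipation.Theorems.DenseLoudDesignerForces.Ergodic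

end
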